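import Summits.Ventures.LatticeQCDFlow.Scoring.BesselToeplitzLaplace
import Summits.Ventures.LatticeQCDFlow.Scoring.GaussVandermondeTraceMoment
import Summits.Ventures.LatticeQCDFlow.Scoring.UNFluxSectors
import Mathlib.Analysis.SpecialFunctions.Complex.Arg
import Mathlib.MeasureTheory.Function.SpecialFunctions.Basic
import HarnessLib

/-!
# The weak-coupling law of the 2-d `U(N)` topological density, every `N`: `β ⟨(arg det U_p)²⟩_β → N`, i.e. `4π² β ⟨q_p²⟩_β → N`

HONEST FRAMING: exact (Metropolis-corrected) sampling algorithms for lattice gauge theory;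
figures of merit are autocorrelation/cost numbers at stated couplings and volumes; no
continuum-physics claim.

Venture `LatticeQCDFlow` (cell pub-lqcd), sub-topic `Scoring`; FANOUT row 5 (`s0-sun-a`), GEN-20.
NEW WORK of the cell (placement rule).  In two dimensions the `U(N)` theory carries topology through its `U(1)` factor: the
topological density of a plaquette is `q_p = arg det U_p / (2π) ∈ (−½, ½]`, and row 3/row 5 treated `U(1)`
(`PlaquetteAngleSecondMomentWeakCoupling`: `β⟨v²⟩_β → 1`, `4π² β χ_∞(β) → 1`).  Here, FOR EVERY `N`, under the `U(N)`
one-plaquette (= 2-d infinite-volume, GEN-19 (24)) law `∝ e^{−β(N − Re tr U)} dU`: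

* §1 `arg_det_torusPt`, **`integral_haar_unitaryGroup_arg_det_sq_mul_exp`** — Weyl's formula for the (measurable, class)
  function `(arg det U)² e^{x Re tr U}`: on the torus `arg det = arg e^{iΣθ_b}`;
* §2 the Laplace limit with the weight `x · (arg e^{iΣ_bφ_b/√x})² → (Σ_bφ_b)²` (eventually equal; dominated through Jordan's
  inequality `u² ≤ (π²/2)(1 − cos u)` on `[−π, π]`): **`tendsto_integral_argWeightedScaledIntegrand`** (`→ N · M_N`, the trace
  moment `∫(Σφ)² e^{−Σφ²/2}Δ² = N·M_N` of `GaussVandermondeTraceMoment`);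
* §3 **`tendsto_mul_unitary_arg_det_sq`** — `β · ⟨(arg det U_p)²⟩_β → N` as `β → ∞`, and
  **`tendsto_mul_unitary_topDensity_sq`** — `4π² · β · ⟨(arg det U_p / 2π)²⟩_β → N`: at weak coupling the 2-d `U(N)`
  topological density per plaquette has second moment `N/(4π²β)·(1 + o(1))` (the `N` eigen-phases add up; `U(1)`: `N = 1`).

No `def`, nothing cited as a fact, 0 sorry.
-/

noncomputable section

open Real MeasureTheory Filter Topology Finset
open scoped ENNReal
open Complex (I)
open Literature.MathematicalPhysics.QuantumFieldTheory (haarProbability)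
open Literature.Analysis.FunctionSpaces (besselI)
open Literature.RepresentationTheory.CompactGroups
open Literature.RepresentationTheory.CompactGroups.WeylIntegration
open Literature.LinearAlgebra.Matrix (diagonalTorus)

namespace Summit.Ventures.LatticeQCDFlow.Scoring

/-! ### 1. Weyl's formula for `(arg det U)² e^{x Re tr U}` -/

/-- On the diagonal torus `det(diag e^{iθ}) = e^{iΣ_bθ_b}`. -/
theorem det_torusPt (N : ℕ) (θ : Fin N → ℝ) :
    ((((torusPt θ : diagonalTorus (Fin N)) : Matrix.unitaryGroup (Fin N) ℂ) : Matrix (Fin N) (Fin N) ℂ).det)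
      = Complex.exp ((∑ b, θ b : ℝ) * I) := by
  rw [coe_torusPt, Matrix.det_diagonal, ← Complex.exp_sum]
  congr 1
  push_cast
  rw [Finset.sum_mul]

/-- Jordan's inequality for the principal argument: `(arg e^{it})² ≤ (π²/2)(1 − cos t)`. -/
theorem arg_exp_sq_le (t : ℝ) :
    Complex.arg (Complex.exp ((t : ℂ) * I)) ^ 2 ≤ π ^ 2 / 2 * (1 - Real.cos t) := by
  set u : ℝ := Complex.arg (Complex.exp ((t : ℂ) * I)) with hu
  have hcos : Real.cos u = Real.cos t := by
    rw [hu, Complex.cos_arg (Complex.exp_ne_zero _), Complex.norm_exp_ofReal_mul_I, div_one, Complex.exp_ofReal_mul_I_re]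
  have hJ := Real.cos_le_one_sub_mul_cos_sq (Complex.abs_arg_le_pi (Complex.exp ((t : ℂ) * I)))
  rw [← hu] at hJ
  rw [← hcos]
  have hπ : (0 : ℝ) < π ^ 2 := by positivity
  have h := mul_le_mul_of_nonneg_left hJ (le_of_lt (half_pos hπ))
  field_simp at h ⊢
  nlinarith [h, hπ]

/-- The torus integrand `(arg e^{iΣθ})² e^{xΣcos θ} Π|e^{iθ_j} − e^{iθ_k}|²` is integrable on the cube
(bounded by `π²` times the unweighted one). -/
theorem integrable_cube_argWeighted (N : ℕ) (x : ℝ) :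
    Integrable (fun θ : Fin N → ℝ => Complex.arg (Complex.exp ((∑ b, θ b : ℝ) * I)) ^ 2 * (Real.exp (x * ∑ b, Real.cos (θ b)) *
            ∏ p : OD (Fin N), ‖Complex.exp (θ p.1.1 * I) - Complex.exp (θ p.1.2 * I)‖ ^ 2))
      (Measure.pi fun _ : Fin N => (volume : Measure ℝ).restrict (Set.Ioc (-π) π)) := by
  have h := integrable_cube_exp_mul_sum_cos_mul_prod_norm_sub_sq (n := Fin N) x
  have hmeas : AEStronglyMeasurable (fun θ : Fin N → ℝ => Complex.arg (Complex.exp ((∑ b, θ b : ℝ) * I)) ^ 2 * (Real.exp (x * ∑ b, Real.cos (θ b)) *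
            ∏ p : OD (Fin N), ‖Complex.exp (θ p.1.1 * I) - Complex.exp (θ p.1.2 * I)‖ ^ 2))
      (Measure.pi fun _ : Fin N => (volume : Measure ℝ).restrict (Set.Ioc (-π) π)) := by
    refine (Measurable.aestronglyMeasurable ?_).mul (Continuous.aestronglyMeasurable ?_)
    · exact (Complex.measurable_arg.comp (by fun_prop : Measurable fun θ : Fin N → ℝ =>
        Complex.exp ((∑ b, θ b : ℝ) * I))).pow_const 2
    · exact (Real.continuous_exp.comp (continuous_const.mul (continuous_finsetSum _ fun b _ =>
        Real.continuous_cos.comp (continuous_apply b)))).mul (continuous_finsetProd _ fun p _ =>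
        ((Complex.continuous_exp.comp ((Complex.continuous_ofReal.comp (continuous_apply _)).mul
          continuous_const)).sub (Complex.continuous_exp.comp ((Complex.continuous_ofReal.comp
          (continuous_apply _)).mul continuous_const))).norm.pow 2)
  refine (h.const_mul (π ^ 2)).mono' hmeas (Eventually.of_forall fun θ => ?_)
  have hF0 : 0 ≤ Real.exp (x * ∑ b, Real.cos (θ b)) *
      ∏ p : OD (Fin N), ‖Complex.exp (θ p.1.1 * I) - Complex.exp (θ p.1.2 * I)‖ ^ 2 :=
    mul_nonneg (Real.exp_nonneg _) (Finset.prod_nonneg fun p _ => sq_nonneg _)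
  have hA : Complex.arg (Complex.exp ((∑ b, θ b : ℝ) * I)) ^ 2 ≤ π ^ 2 := by
    rw [← sq_abs]
    exact pow_le_pow_left₀ (abs_nonneg _) (Complex.abs_arg_le_pi _) 2
  rw [Real.norm_eq_abs, abs_of_nonneg (mul_nonneg (sq_nonneg _) hF0)]
  exact mul_le_mul_of_nonneg_right hA hF0

/-- **Weyl's formula for the class function `(arg det U)² e^{x Re tr U}`** on `U(N)`:
`∫_{U(N)} (arg det U)² e^{x Re tr U} dU = ((2π)^N N!)⁻¹ ∫_{(−π,π]^N} (arg e^{iΣ_bθ_b})² e^{xΣcos θ_b} Π_{j≺k}|e^{iθ_j} − e^{iθ_k}|² dθ`. -/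
theorem integral_haar_unitaryGroup_arg_det_sq_mul_exp (N : ℕ) (x : ℝ) :
    ∫ u, (Complex.arg ((u : Matrix.unitaryGroup (Fin N) ℂ) : Matrix (Fin N) (Fin N) ℂ).det ^ 2 * Real.exp (x * ((u : Matrix.unitaryGroup (Fin N) ℂ) : Matrix (Fin N) (Fin N) ℂ).trace.re)) ∂(haarProbability (Matrix.unitaryGroup (Fin N) ℂ))
      = ((2 * π) ^ N * N.factorial)⁻¹ *
        ∫ θ, Complex.arg (Complex.exp ((∑ b, θ b : ℝ) * I)) ^ 2 * (Real.exp (x * ∑ b, Real.cos (θ b)) *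
            ∏ p : OD (Fin N), ‖Complex.exp (θ p.1.1 * I) - Complex.exp (θ p.1.2 * I)‖ ^ 2)
          ∂(Measure.pi fun _ : Fin N => (volume : Measure ℝ).restrict (Set.Ioc (-π) π)) := by
  have htr : Continuous fun u : Matrix.unitaryGroup (Fin N) ℂ => ((u : Matrix.unitaryGroup (Fin N) ℂ) : Matrix (Fin N) (Fin N) ℂ).trace.re :=
    Complex.continuous_re.comp (continuous_id.matrix_trace.comp continuous_subtype_val)
  have hdet : Continuous fun u : Matrix.unitaryGroup (Fin N) ℂ => ((u : Matrix.unitaryGroup (Fin N) ℂ) : Matrix (Fin N) (Fin N) ℂ).det :=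
    continuous_id.matrix_det.comp continuous_subtype_val
  have hGm : Measurable fun u : Matrix.unitaryGroup (Fin N) ℂ => (Complex.arg ((u : Matrix.unitaryGroup (Fin N) ℂ) : Matrix (Fin N) (Fin N) ℂ).det ^ 2 * Real.exp (x * ((u : Matrix.unitaryGroup (Fin N) ℂ) : Matrix (Fin N) (Fin N) ℂ).trace.re)) :=
    ((Complex.measurable_arg.comp hdet.measurable).pow_const 2).mul
      (Real.continuous_exp.comp (continuous_const.mul htr)).measurable
  have hG0 : ∀ u : Matrix.unitaryGroup (Fin N) ℂ, 0 ≤ (Complex.arg ((u : Matrix.unitaryGroup (Fin N) ℂ) : Matrix (Fin N) (Fin N) ℂ).det ^ 2 * Real.exp (x * ((u : Matrix.unitaryGroup (Fin N) ℂ) : Matrix (Fin N) (Fin N) ℂ).trace.re)) := fun u =>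
    mul_nonneg (sq_nonneg _) (Real.exp_nonneg _)
  have hF : Measurable fun u : Matrix.unitaryGroup (Fin N) ℂ => ENNReal.ofReal (Complex.arg ((u : Matrix.unitaryGroup (Fin N) ℂ) : Matrix (Fin N) (Fin N) ℂ).det ^ 2 * Real.exp (x * ((u : Matrix.unitaryGroup (Fin N) ℂ) : Matrix (Fin N) (Fin N) ℂ).trace.re)) :=
    ENNReal.measurable_ofReal.comp hGm
  have hcl : ∀ g u : Matrix.unitaryGroup (Fin N) ℂ, ENNReal.ofReal
      (Complex.arg (((g * u * g⁻¹ : Matrix.unitaryGroup (Fin N) ℂ)) : Matrix (Fin N) (Fin N) ℂ).det ^ 2 *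
        Real.exp (x * (((g * u * g⁻¹ : Matrix.unitaryGroup (Fin N) ℂ)) : Matrix (Fin N) (Fin N) ℂ).trace.re))
      = ENNReal.ofReal (Complex.arg ((u : Matrix.unitaryGroup (Fin N) ℂ) : Matrix (Fin N) (Fin N) ℂ).det ^ 2 * Real.exp (x * ((u : Matrix.unitaryGroup (Fin N) ℂ) : Matrix (Fin N) (Fin N) ℂ).trace.re)) := by
    intro g u
    rw [det_conj_unitaryGroup, trace_conj_unitaryGroup]
  have hW := lintegral_unitaryGroup_eq_angleIntegral hF hcl
  rw [angleIntegral] at hW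
  simp_rw [trace_re_torusPt, det_torusPt] at hW
  rw [show (volume : Measure (Fin N → ℝ)).restrict (Set.pi Set.univ fun _ => Set.Ioc (-π) π) =
    Measure.pi fun _ : Fin N => (volume : Measure ℝ).restrict (Set.Ioc (-π) π) from Measure.restrict_pi_pi _ _] at hW
  have hprod : ∀ θ : Fin N → ℝ,
      ENNReal.ofReal (Complex.arg (Complex.exp ((∑ b, θ b : ℝ) * I)) ^ 2 * Real.exp (x * ∑ b, Real.cos (θ b))) * ENNReal.ofReal (∏ p : OD (Fin N), ‖Complex.exp (θ p.1.1 * I) - Complex.exp (θ p.1.2 * I)‖ ^ 2)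
      = ENNReal.ofReal (Complex.arg (Complex.exp ((∑ b, θ b : ℝ) * I)) ^ 2 * (Real.exp (x * ∑ b, Real.cos (θ b)) *
            ∏ p : OD (Fin N), ‖Complex.exp (θ p.1.1 * I) - Complex.exp (θ p.1.2 * I)‖ ^ 2)) := by
    intro θ
    rw [← ENNReal.ofReal_mul (mul_nonneg (sq_nonneg _) (Real.exp_nonneg _)), mul_assoc]
  simp_rw [hprod] at hW
  have hnn : ∀ θ : Fin N → ℝ, 0 ≤ Complex.arg (Complex.exp ((∑ b, θ b : ℝ) * I)) ^ 2 * (Real.exp (x * ∑ b, Real.cos (θ b)) *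
            ∏ p : OD (Fin N), ‖Complex.exp (θ p.1.1 * I) - Complex.exp (θ p.1.2 * I)‖ ^ 2) := fun θ =>
    mul_nonneg (sq_nonneg _) (mul_nonneg (Real.exp_nonneg _) (Finset.prod_nonneg fun p _ => sq_nonneg _))
  rw [← ofReal_integral_eq_lintegral_ofReal (integrable_cube_argWeighted N x) (Eventually.of_forall hnn)] at hW
  rw [integral_eq_lintegral_of_nonneg_ae (Eventually.of_forall hG0) hGm.aestronglyMeasurable, hW]
  simp only [Fintype.card_fin, ENNReal.toReal_mul, ENNReal.toReal_inv, ENNReal.toReal_pow,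
    ENNReal.toReal_ofReal Real.two_pi_pos.le, ENNReal.toReal_natCast, ENNReal.toReal_ofReal (integral_nonneg hnn)]

/-! ### 2. The Laplace limit with the weight `x · (arg e^{iΣφ_b/√x})²` -/

/-- The weight is dominated: `0 ≤ x (arg e^{iΣ_bφ_b/√x})² ≤ (π²/4) N Σ_b φ_b²` for `x > 0`. -/
theorem argWeight_mem_Icc {N : ℕ} {x : ℝ} (hx : 0 < x) (φ : Fin N → ℝ) :
    0 ≤ (x * Complex.arg (Complex.exp ((∑ b, φ b / √x : ℝ) * I)) ^ 2) ∧ (x * Complex.arg (Complex.exp ((∑ b, φ b / √x : ℝ) * I)) ^ 2) ≤ π ^ 2 / 4 * (N * ∑ b, φ b ^ 2) := by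
  refine ⟨mul_nonneg hx.le (sq_nonneg _), ?_⟩
  have hJ := arg_exp_sq_le (∑ b, φ b / √x)
  have hc := neg_sq_div_two_le_mul_cos_div_sqrt_sub_one hx (∑ b, φ b)
  have hsum : ∑ b, φ b / √x = (∑ b, φ b) / √x := by rw [Finset.sum_div]
  rw [hsum] at hJ
  have hCS : (∑ b, φ b) ^ 2 ≤ N * ∑ b, φ b ^ 2 := by
    have h := sq_sum_le_card_mul_sum_sq (s := (Finset.univ : Finset (Fin N))) (f := fun b => φ b)
    simpa using h
  have hπ : (0 : ℝ) ≤ π ^ 2 / 2 := by positivity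
  calc (x * Complex.arg (Complex.exp ((∑ b, φ b / √x : ℝ) * I)) ^ 2)
      = x * Complex.arg (Complex.exp ((((∑ b, φ b) / √x : ℝ) : ℂ) * I)) ^ 2 := by rw [hsum]
    _ ≤ x * (π ^ 2 / 2 * (1 - Real.cos ((∑ b, φ b) / √x))) := mul_le_mul_of_nonneg_left hJ hx.le
    _ = π ^ 2 / 2 * (-(x * (Real.cos ((∑ b, φ b) / √x) - 1))) := by ring
    _ ≤ π ^ 2 / 2 * ((∑ b, φ b) ^ 2 / 2) := mul_le_mul_of_nonneg_left (by linarith) hπ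
    _ ≤ π ^ 2 / 4 * (N * ∑ b, φ b ^ 2) := by nlinarith [hCS, Real.pi_pos]

/-- The weight is eventually equal to `(Σ_bφ_b)²`, hence tends to it. -/
theorem tendsto_argWeight {N : ℕ} (φ : Fin N → ℝ) :
    Tendsto (fun x : ℝ => (x * Complex.arg (Complex.exp ((∑ b, φ b / √x : ℝ) * I)) ^ 2)) atTop (𝓝 ((∑ b, φ b) ^ 2)) := by
  refine tendsto_const_nhds.congr' ?_
  filter_upwards [eventually_gt_atTop ((∑ b, φ b) ^ 2 / π ^ 2), eventually_gt_atTop (0 : ℝ)] with x hx hx0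
  have hsx : 0 < √x := Real.sqrt_pos.2 hx0
  have hsum : ∑ b, φ b / √x = (∑ b, φ b) / √x := by rw [Finset.sum_div]
  -- `|Σφ/√x| < π`
  have habs : |(∑ b, φ b) / √x| < π := by
    rw [abs_div, abs_of_pos hsx, div_lt_iff₀ hsx]
    have h1 : (∑ b, φ b) ^ 2 < (π * √x) ^ 2 := by
      rw [mul_pow, Real.sq_sqrt hx0.le]
      have hπ : (0 : ℝ) < π ^ 2 := by positivity
      rw [div_lt_iff₀ hπ] at hx
      linarith
    have h2 : 0 ≤ π * √x := by positivity
    exact abs_lt_of_sq_lt_sq h1 h2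
  have harg : Complex.arg (Complex.exp ((((∑ b, φ b) / √x : ℝ) : ℂ) * I)) = (∑ b, φ b) / √x := by
    rw [Complex.exp_mul_I]
    exact Complex.arg_cos_add_sin_mul_I ⟨by linarith [(abs_lt.1 habs).1], (abs_lt.1 habs).2.le⟩
  rw [hsum, harg, div_pow, Real.sq_sqrt hx0.le]
  field_simp

/-- **Change of variables for the arg-weighted integrand** (`x > 0`). -/
theorem integral_argWeightedScaledIntegrand_eq {N : ℕ} {x : ℝ} (hx : 0 < x) :
    ∫ φ : Fin N → ℝ, (x * Complex.arg (Complex.exp ((∑ b, φ b / √x : ℝ) * I)) ^ 2) *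
        ((fun φ : Fin N → ℝ => fun b => φ b / √x) ⁻¹' Set.univ.pi fun _ => Set.Ioc (-π) π).indicator
          (fun φ => Real.exp (∑ b, x * (Real.cos (φ b / √x) - 1)) *
            ∏ p : OD (Fin N), (2 * x * (1 - Real.cos ((φ p.1.1 - φ p.1.2) / √x)))) φ
      = Real.exp (-(N * x)) * x ^ Fintype.card (OD (Fin N)) * √x ^ N *
        ∫ θ, (x * Complex.arg (Complex.exp ((∑ b, θ b : ℝ) * I)) ^ 2) * (Real.exp (x * ∑ b, Real.cos (θ b)) *
            ∏ p : OD (Fin N), ‖Complex.exp (θ p.1.1 * I) - Complex.exp (θ p.1.2 * I)‖ ^ 2)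
          ∂(Measure.pi fun _ : Fin N => (volume : Measure ℝ).restrict (Set.Ioc (-π) π)) := by
  have hsx : 0 < √x := Real.sqrt_pos.2 hx
  set c : ℝ := (√x)⁻¹ with hc
  set F : (Fin N → ℝ) → ℝ := fun θ => (x * Complex.arg (Complex.exp ((∑ b, θ b : ℝ) * I)) ^ 2) * (Real.exp (x * ∑ b, Real.cos (θ b)) *
    ∏ p : OD (Fin N), (2 - 2 * Real.cos (θ p.1.1 - θ p.1.2))) with hF
  set cube : Set (Fin N → ℝ) := Set.univ.pi fun _ => Set.Ioc (-π) π with hcube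
  have hcube_meas : MeasurableSet cube := MeasurableSet.univ_pi fun _ => measurableSet_Ioc
  have htorus : ∫ θ, (x * Complex.arg (Complex.exp ((∑ b, θ b : ℝ) * I)) ^ 2) * (Real.exp (x * ∑ b, Real.cos (θ b)) *
            ∏ p : OD (Fin N), ‖Complex.exp (θ p.1.1 * I) - Complex.exp (θ p.1.2 * I)‖ ^ 2)
        ∂(Measure.pi fun _ : Fin N => (volume : Measure ℝ).restrict (Set.Ioc (-π) π))
      = ∫ θ : Fin N → ℝ, cube.indicator F θ := by
    simp_rw [norm_cexp_sub_cexp_sq]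
    rw [← Measure.restrict_pi_pi, ← volume_pi, integral_indicator hcube_meas]
  have hscale : ∀ φ : Fin N → ℝ, (fun b => φ b / √x) = c • φ := by
    intro φ; funext b; simp [hc, div_eq_inv_mul]
  have hsumscale : ∀ φ : Fin N → ℝ, (∑ b, φ b / √x) = ∑ b, (c • φ) b := by
    intro φ; rw [← hscale]
  have hind : ∀ φ : Fin N → ℝ, (x * Complex.arg (Complex.exp ((∑ b, φ b / √x : ℝ) * I)) ^ 2) *
      ((fun φ : Fin N → ℝ => fun b => φ b / √x) ⁻¹' cube).indicator
        (fun φ => Real.exp (∑ b, x * (Real.cos (φ b / √x) - 1)) *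
          ∏ p : OD (Fin N), (2 * x * (1 - Real.cos ((φ p.1.1 - φ p.1.2) / √x)))) φ
      = Real.exp (-(N * x)) * x ^ Fintype.card (OD (Fin N)) * (cube.indicator F) (c • φ) := by
    intro φ
    by_cases hφ : (fun b => φ b / √x) ∈ cube
    · rw [Set.indicator_of_mem (show φ ∈ (fun φ : Fin N → ℝ => fun b => φ b / √x) ⁻¹' cube from hφ),
        Set.indicator_of_mem (show c • φ ∈ cube by rwa [← hscale]), scaledIntegrand_eq_mul, hF, hsumscale, ← hscale]
      simp only [Fintype.card_fin]
      ring
    · rw [Set.indicator_of_notMem (show φ ∉ (fun φ : Fin N → ℝ => fun b => φ b / √x) ⁻¹' cube from hφ),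
        Set.indicator_of_notMem (show c • φ ∉ cube by rwa [← hscale]), mul_zero, mul_zero]
  simp_rw [hind]
  rw [integral_const_mul, Measure.integral_comp_smul volume (cube.indicator F) c, htorus,
    Module.finrank_fintype_fun_eq_card, smul_eq_mul]
  have hcN : |(c ^ Fintype.card (Fin N))⁻¹| = √x ^ N := by
    rw [Fintype.card_fin, hc, inv_pow, inv_inv, abs_of_pos (pow_pos hsx _)]
  rw [hcN]
  ring

/-- **The arg-weighted Laplace limit**: `∫ (weight) × (scaled integrand) → ∫ (Σφ)² e^{−Σφ²/2} Δ² = N · M_N`. -/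
theorem tendsto_integral_argWeightedScaledIntegrand (N : ℕ) :
    Tendsto (fun x : ℝ => ∫ φ : Fin N → ℝ, (x * Complex.arg (Complex.exp ((∑ b, φ b / √x : ℝ) * I)) ^ 2) *
        ((fun φ : Fin N → ℝ => fun b => φ b / √x) ⁻¹' Set.univ.pi fun _ => Set.Ioc (-π) π).indicator
          (fun φ => Real.exp (∑ b, x * (Real.cos (φ b / √x) - 1)) *
            ∏ p : OD (Fin N), (2 * x * (1 - Real.cos ((φ p.1.1 - φ p.1.2) / √x)))) φ)
      atTop (𝓝 ((N : ℝ) * ∫ φ : Fin N → ℝ, Real.exp (∑ b, -(φ b ^ 2 / 2)) * ∏ p : OD (Fin N), (φ p.1.1 - φ p.1.2) ^ 2)) := by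
  have hlim : (N : ℝ) * (∫ φ : Fin N → ℝ, Real.exp (∑ b, -(φ b ^ 2 / 2)) * ∏ p : OD (Fin N), (φ p.1.1 - φ p.1.2) ^ 2) = ∫ φ : Fin N → ℝ, (∑ b, φ b) ^ 2 * (Real.exp (∑ b, -(φ b ^ 2 / 2)) * ∏ p : OD (Fin N), (φ p.1.1 - φ p.1.2) ^ 2) := by
    have h := integral_sumSq_gaussVandermonde (n := Fin N)
    simp only [Fintype.card_fin] at h
    rw [h]
  rw [hlim]
  refine tendsto_integral_filter_of_dominated_convergence
    (fun φ => (π ^ 2 / 4 * N) * (2 ^ Fintype.card (OD (Fin N)) * ∏ b, (Real.exp (-(2 / π ^ 2 * φ b ^ 2)) *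
      (1 + φ b ^ 2) ^ (Fintype.card (OD (Fin N)) + 1)))) ?_ ?_ ((integrable_gaussPolyBound _ _).const_mul _)
    (Eventually.of_forall fun φ => (tendsto_argWeight φ).mul (tendsto_scaledIntegrand φ))
  · filter_upwards [eventually_gt_atTop (0 : ℝ)] with x hx
    refine (Measurable.aestronglyMeasurable ?_).mul (AEStronglyMeasurable.indicator ?_ ?_)
    · exact measurable_const.mul ((Complex.measurable_arg.comp (by fun_prop : Measurable fun φ : Fin N → ℝ =>
        Complex.exp ((∑ b, φ b / √x : ℝ) * I))).pow_const 2)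
    · exact (by fun_prop : Continuous fun φ : Fin N → ℝ => Real.exp (∑ b, x * (Real.cos (φ b / √x) - 1)) *
        ∏ p : OD (Fin N), (2 * x * (1 - Real.cos ((φ p.1.1 - φ p.1.2) / √x)))).aestronglyMeasurable
    · exact (MeasurableSet.univ_pi fun _ => measurableSet_Ioc).preimage (by fun_prop)
  · filter_upwards [eventually_gt_atTop (0 : ℝ)] with x hx
    refine Eventually.of_forall fun φ => ?_
    have hw := argWeight_mem_Icc hx φ
    rw [norm_mul, Real.norm_eq_abs, abs_of_nonneg hw.1, Real.norm_eq_abs]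
    by_cases hφ : φ ∈ (fun φ : Fin N → ℝ => fun b => φ b / √x) ⁻¹' Set.univ.pi fun _ => Set.Ioc (-π) π
    · rw [Set.indicator_of_mem hφ, abs_of_nonneg (mul_nonneg (Real.exp_nonneg _)
        (Finset.prod_nonneg fun p _ => pairFactor_nonneg hx.le _))]
      have hb := scaledIntegrand_le_bound hx fun b => hφ b (Set.mem_univ _)
      have hsum : π ^ 2 / 4 * (N * ∑ b, φ b ^ 2) ≤ (π ^ 2 / 4 * N) * ∏ b, (1 + φ b ^ 2) := by
        rw [mul_assoc]
        exact mul_le_mul_of_nonneg_left (mul_le_mul_of_nonneg_left (sum_sq_le_prod_one_add_sq φ) (Nat.cast_nonneg _))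
          (by positivity)
      calc (x * Complex.arg (Complex.exp ((∑ b, φ b / √x : ℝ) * I)) ^ 2) * (Real.exp (∑ b, x * (Real.cos (φ b / √x) - 1)) *
            ∏ p : OD (Fin N), (2 * x * (1 - Real.cos ((φ p.1.1 - φ p.1.2) / √x))))
          ≤ ((π ^ 2 / 4 * N) * ∏ b, (1 + φ b ^ 2)) * (2 ^ Fintype.card (OD (Fin N)) *
            ∏ b, (Real.exp (-(2 / π ^ 2 * φ b ^ 2)) * (1 + φ b ^ 2) ^ Fintype.card (OD (Fin N)))) :=
            mul_le_mul (hw.2.trans hsum) hb (mul_nonneg (Real.exp_nonneg _)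
              (Finset.prod_nonneg fun p _ => pairFactor_nonneg hx.le _)) (by positivity)
        _ = (π ^ 2 / 4 * N) * (2 ^ Fintype.card (OD (Fin N)) * ∏ b, (Real.exp (-(2 / π ^ 2 * φ b ^ 2)) *
            (1 + φ b ^ 2) ^ (Fintype.card (OD (Fin N)) + 1))) := by
            rw [mul_assoc, mul_left_comm (∏ b, (1 + φ b ^ 2)), ← Finset.prod_mul_distrib]
            congr 2
            exact Finset.prod_congr rfl fun b _ => by ring
    · rw [Set.indicator_of_notMem hφ, abs_zero, mul_zero]
      positivity

/-! ### 3. The weak-coupling law of the topological density -/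

/-- **`x · ⟨(arg det U)²⟩_x → N`** in mgf normalisation: `x ∫ (arg det U)² e^{x Re tr U} dU / det[I_{|i−j|}(x)] → N`. -/
theorem tendsto_mul_unitary_arg_det_sq_div_det (N : ℕ) :
    Tendsto (fun x : ℝ => x * (∫ u, (Complex.arg ((u : Matrix.unitaryGroup (Fin N) ℂ) : Matrix (Fin N) (Fin N) ℂ).det ^ 2 * Real.exp (x * ((u : Matrix.unitaryGroup (Fin N) ℂ) : Matrix (Fin N) (Fin N) ℂ).trace.re)) ∂(haarProbability (Matrix.unitaryGroup (Fin N) ℂ))) / (Matrix.of fun i j : Fin N => besselI ((i : ℤ) - (j : ℤ)).natAbs x).det)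
      atTop (𝓝 (N : ℝ)) := by
  set M : ℝ := ∫ φ : Fin N → ℝ, Real.exp (∑ b, -(φ b ^ 2 / 2)) * ∏ p : OD (Fin N), (φ p.1.1 - φ p.1.2) ^ 2 with hM
  have hMpos : 0 < M := gaussVandermonde_pos (n := Fin N)
  have hK : (0 : ℝ) < (2 * π) ^ N * N.factorial := by positivity
  have hden := tendsto_det_besselI_toeplitz_weakCoupling N
  have hnum : Tendsto (fun x : ℝ => x * (∫ u, (Complex.arg ((u : Matrix.unitaryGroup (Fin N) ℂ) : Matrix (Fin N) (Fin N) ℂ).det ^ 2 * Real.exp (x * ((u : Matrix.unitaryGroup (Fin N) ℂ) : Matrix (Fin N) (Fin N) ℂ).trace.re)) ∂(haarProbability (Matrix.unitaryGroup (Fin N) ℂ))) *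
      Real.exp (-(N * x)) * √x ^ (N ^ 2)) atTop (𝓝 ((N : ℝ) * M / ((2 * π) ^ N * N.factorial))) := by
    have h := (tendsto_integral_argWeightedScaledIntegrand N).div_const ((2 * π) ^ N * N.factorial)
    refine h.congr' ?_
    filter_upwards [eventually_gt_atTop (0 : ℝ)] with x hx
    have hpow : √x ^ (N ^ 2) = x ^ Fintype.card (OD (Fin N)) * √x ^ N := by
      have hc := card_add_two_mul_card_OD (n := Fin N)
      simp only [Fintype.card_fin] at hc
      rw [← hc, pow_add, pow_mul, Real.sq_sqrt hx.le, mul_comm]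
    have hI : ∫ θ, (x * Complex.arg (Complex.exp ((∑ b, θ b : ℝ) * I)) ^ 2) * (Real.exp (x * ∑ b, Real.cos (θ b)) *
            ∏ p : OD (Fin N), ‖Complex.exp (θ p.1.1 * I) - Complex.exp (θ p.1.2 * I)‖ ^ 2)
        ∂(Measure.pi fun _ : Fin N => (volume : Measure ℝ).restrict (Set.Ioc (-π) π))
        = x * ∫ θ, Complex.arg (Complex.exp ((∑ b, θ b : ℝ) * I)) ^ 2 * (Real.exp (x * ∑ b, Real.cos (θ b)) *
            ∏ p : OD (Fin N), ‖Complex.exp (θ p.1.1 * I) - Complex.exp (θ p.1.2 * I)‖ ^ 2)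
          ∂(Measure.pi fun _ : Fin N => (volume : Measure ℝ).restrict (Set.Ioc (-π) π)) := by
      rw [← integral_const_mul]
      refine integral_congr_ae (Eventually.of_forall fun θ => ?_)
      ring
    rw [integral_argWeightedScaledIntegrand_eq (N := N) hx, hI, integral_haar_unitaryGroup_arg_det_sq_mul_exp, hpow]
    set J : ℝ := ∫ θ, Complex.arg (Complex.exp ((∑ b, θ b : ℝ) * I)) ^ 2 * (Real.exp (x * ∑ b, Real.cos (θ b)) *
            ∏ p : OD (Fin N), ‖Complex.exp (θ p.1.1 * I) - Complex.exp (θ p.1.2 * I)‖ ^ 2)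
        ∂(Measure.pi fun _ : Fin N => (volume : Measure ℝ).restrict (Set.Ioc (-π) π)) with hJ
    field_simp
  have hne : M / ((2 * π) ^ N * N.factorial) ≠ 0 := (div_pos hMpos hK).ne'
  have hq := hnum.div hden hne
  have hval : (N : ℝ) * M / ((2 * π) ^ N * N.factorial) / (M / ((2 * π) ^ N * N.factorial)) = N := by
    field_simp
  rw [hval] at hq
  refine hq.congr' ?_
  filter_upwards [eventually_gt_atTop (0 : ℝ)] with x hx
  simp only [Pi.div_apply]
  have hD := det_besselI_toeplitz_fin_pos N x
  have hE : Real.exp (-(N * x)) * √x ^ (N ^ 2) ≠ 0 := by positivity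
  field_simp

/-- **THE WEAK-COUPLING LAW OF THE 2-d `U(N)` TOPOLOGICAL ANGLE, EVERY `N`**: under the `U(N)` one-plaquette (and, in two
dimensions, infinite-volume) law `∝ e^{−β(N − Re tr U)} dU`, `β · ⟨(arg det U_p)²⟩_β → N` as `β → ∞`. -/
theorem tendsto_mul_unitary_arg_det_sq (N : ℕ) :
    Tendsto (fun β : ℝ => β * ((∫ u, Complex.arg ((u : Matrix.unitaryGroup (Fin N) ℂ) : Matrix (Fin N) (Fin N) ℂ).det ^ 2 * Real.exp (-(β * ((N : ℝ) - ((u : Matrix.unitaryGroup (Fin N) ℂ) : Matrix (Fin N) (Fin N) ℂ).trace.re))) ∂(haarProbability (Matrix.unitaryGroup (Fin N) ℂ))) / (∫ u, Real.exp (-(β * ((N : ℝ) - ((u : Matrix.unitaryGroup (Fin N) ℂ) : Matrix (Fin N) (Fin N) ℂ).trace.re))) ∂(haarProbability (Matrix.unitaryGroup (Fin N) ℂ))))) atTop (𝓝 (N : ℝ)) := by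
  refine (tendsto_mul_unitary_arg_det_sq_div_det N).congr' ?_
  filter_upwards [eventually_gt_atTop (0 : ℝ)] with β hβ
  have hsplit : ∀ u : Matrix.unitaryGroup (Fin N) ℂ, Real.exp (-(β * ((N : ℝ) - ((u : Matrix.unitaryGroup (Fin N) ℂ) : Matrix (Fin N) (Fin N) ℂ).trace.re))) = Real.exp (-(N * β)) * Real.exp (β * ((u : Matrix.unitaryGroup (Fin N) ℂ) : Matrix (Fin N) (Fin N) ℂ).trace.re) := by
    intro u; rw [← Real.exp_add]; congr 1; ring
  simp_rw [hsplit]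
  have h1 : ∀ u : Matrix.unitaryGroup (Fin N) ℂ, Complex.arg ((u : Matrix.unitaryGroup (Fin N) ℂ) : Matrix (Fin N) (Fin N) ℂ).det ^ 2 * (Real.exp (-(N * β)) * Real.exp (β * ((u : Matrix.unitaryGroup (Fin N) ℂ) : Matrix (Fin N) (Fin N) ℂ).trace.re))
      = Real.exp (-(N * β)) * (Complex.arg ((u : Matrix.unitaryGroup (Fin N) ℂ) : Matrix (Fin N) (Fin N) ℂ).det ^ 2 * Real.exp (β * ((u : Matrix.unitaryGroup (Fin N) ℂ) : Matrix (Fin N) (Fin N) ℂ).trace.re)) := fun u => by ring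
  simp_rw [h1]
  rw [integral_const_mul, integral_const_mul, integral_haar_unitaryGroup_fin_exp_mul_trace_re]
  have hD := det_besselI_toeplitz_fin_pos N β
  have he : Real.exp (-(N * β)) ≠ 0 := (Real.exp_pos _).ne'
  field_simp

/-- **`4π² · β · ⟨q_p²⟩_β → N`** for the topological density `q_p = arg det U_p / (2π)` of 2-d `U(N)`, every `N`. -/
theorem tendsto_mul_unitary_topDensity_sq (N : ℕ) :
    Tendsto (fun β : ℝ => 4 * π ^ 2 * (β * ((∫ u, (Complex.arg ((u : Matrix.unitaryGroup (Fin N) ℂ) : Matrix (Fin N) (Fin N) ℂ).det / (2 * π)) ^ 2 * Real.exp (-(β * ((N : ℝ) - ((u : Matrix.unitaryGroup (Fin N) ℂ) : Matrix (Fin N) (Fin N) ℂ).trace.re))) ∂(haarProbability (Matrix.unitaryGroup (Fin N) ℂ)))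
      / (∫ u, Real.exp (-(β * ((N : ℝ) - ((u : Matrix.unitaryGroup (Fin N) ℂ) : Matrix (Fin N) (Fin N) ℂ).trace.re))) ∂(haarProbability (Matrix.unitaryGroup (Fin N) ℂ)))))) atTop (𝓝 (N : ℝ)) := by
  have h := tendsto_mul_unitary_arg_det_sq N
  refine h.congr fun β => ?_
  have e : ∀ u : Matrix.unitaryGroup (Fin N) ℂ, (Complex.arg ((u : Matrix.unitaryGroup (Fin N) ℂ) : Matrix (Fin N) (Fin N) ℂ).det / (2 * π)) ^ 2 * Real.exp (-(β * ((N : ℝ) - ((u : Matrix.unitaryGroup (Fin N) ℂ) : Matrix (Fin N) (Fin N) ℂ).trace.re)))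
      = 1 / (4 * π ^ 2) * (Complex.arg ((u : Matrix.unitaryGroup (Fin N) ℂ) : Matrix (Fin N) (Fin N) ℂ).det ^ 2 * Real.exp (-(β * ((N : ℝ) - ((u : Matrix.unitaryGroup (Fin N) ℂ) : Matrix (Fin N) (Fin N) ℂ).trace.re)))) := fun u => by
    field_simp
    ring
  simp_rw [e]
  rw [integral_const_mul]
  have hπ : (π : ℝ) ≠ 0 := Real.pi_pos.ne'
  field_simp

end Summit.Ventures.LatticeQCDFlow.Scoring
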